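import Mathlib
import Literature.AlgebraicGeometry.Resolution.WeightedCentreCharacterSum

/-!
# Character projection inside a group (engine 1's `W(f)` toy model, target T101 — an instrument, NOT a resolution theorem)

STEP 1 of the EIGEN-LIFT LEMMA (RE-DERIVATION-eng1-g43 §3.2; CARVER-NOTES-eng1-g43 §2 T101) in abstract form.  Setting: a group `G` (the
toy model's `H = ⟨s_μ X⟩`), a subgroup `N` (a level `H ∩ 𝔄_{m}` of the order filtration), a map `π : G → M` into an `𝔽_p`-module which is
additive on `N` (the level projection `π_m` of (F3), or the bottom-class character `c` of (F6)), and elements `g μ ∈ N`, `μ ∈ 𝔽_pˣ` (the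
`s_μ X`) on which `π` takes the values `μ^m • x` ((F4): `π_m (s_μ X) = μ^m π_m X`; (F6): `c (s_μ X) = μ^r c X`).  Then the word
`Y := ∏_μ (g μ)^{c(μ)}`, `c(μ) ≡ -μ^{-r} (mod p)`, lies in `N` and `π Y = [m = r] • x` (`character_projection`): the projection kills every
level `m ≢ r` and keeps the character-`r` datum.  The only arithmetic input is the unit character sum `Σ_μ μ^{-r} μ^{m} = -[p-1 ∣ m-r]`
(`CharacterSum.sum_units_inv_pow_mul_pow`).  No hypothesis `(P)`, no polynomial algebra.
-/

namespace Literature.AlgebraicGeometry.Resolution.WeightedBlowup.EigenProjection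

variable {G : Type*} [Group G] {M : Type*} [AddCommGroup M]

/-- A map additive on a subgroup vanishes at `1` (bookkeeping). [cite: Lang2002, Ch. I §3] -/
theorem apply_one_eq_zero (N : Subgroup G) (π : G → M) (hπ : ∀ a ∈ N, ∀ b ∈ N, π (a * b) = π a + π b) : π 1 = 0 := by
  have h := hπ 1 N.one_mem 1 N.one_mem
  rw [mul_one] at h
  simpa using h

/-- A map additive on a subgroup turns words in the subgroup into sums (bookkeeping). [cite: Lang2002, Ch. I §3] -/
theorem prod_mem_and_apply_prod (N : Subgroup G) (π : G → M) (hπ : ∀ a ∈ N, ∀ b ∈ N, π (a * b) = π a + π b) :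
    ∀ L : List G, (∀ a ∈ L, a ∈ N) → L.prod ∈ N ∧ π L.prod = (L.map π).sum
  | [], _ => ⟨by simp, by simpa using apply_one_eq_zero N π hπ⟩
  | a :: L, h => by
    have ha : a ∈ N := h a (List.mem_cons.mpr (Or.inl rfl))
    obtain ⟨h1, h2⟩ := prod_mem_and_apply_prod N π hπ L fun b hb => h b (List.mem_cons_of_mem a hb)
    refine ⟨by rw [List.prod_cons]; exact N.mul_mem ha h1, ?_⟩
    rw [List.prod_cons, List.map_cons, List.sum_cons, hπ a ha _ h1, h2]

/-- A map additive on a subgroup turns powers into multiples (bookkeeping). [cite: Lang2002, Ch. I §3] -/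
theorem apply_pow_eq_nsmul (N : Subgroup G) (π : G → M) (hπ : ∀ a ∈ N, ∀ b ∈ N, π (a * b) = π a + π b) {a : G}
    (ha : a ∈ N) : ∀ n : ℕ, π (a ^ n) = n • π a
  | 0 => by rw [pow_zero, zero_smul]; exact apply_one_eq_zero N π hπ
  | n + 1 => by rw [pow_succ, hπ _ (N.pow_mem ha n) a ha, apply_pow_eq_nsmul N π hπ ha n, succ_nsmul]

/-- The exponents of the projecting word: `c(μ) ∈ ℕ` with `c(μ) ≡ -μ^{-r} (mod p)`. [cite: Lang2002, Ch. V §5] -/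
def expo (p : ℕ) (r : ℕ) (μ : (ZMod p)ˣ) : ℕ := (-(((μ⁻¹ : (ZMod p)ˣ) : ZMod p) ^ r)).val

/-- The projecting word `Y = ∏_μ (g μ)^{c(μ)}` (product over `𝔽_pˣ` in the enumeration order of `Finset.univ.toList`; the group need not be
commutative). [cite: Lang2002, Ch. V §5; AbramovichTemkinWlodarczyk2024, §5.1 (p. 1575)] -/
noncomputable def word (p : ℕ) [NeZero p] (r : ℕ) (g : (ZMod p)ˣ → G) : G :=
  ((Finset.univ : Finset (ZMod p)ˣ).toList.map fun μ => g μ ^ expo p r μ).prod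

/-- **Character projection inside a group** (RE-DERIVATION-eng1-g43 §3.2, EIGEN-LIFT STEP 1, abstract form; instrument for engine 1's `W(f)` toy
model, NOT a resolution theorem).  If `π` is additive on `N ∋ g μ` with `π (g μ) = μ^m • x` (`1 ≤ m ≤ p`, `2 ≤ r ≤ p - 1`), then the word
`Y = ∏_μ (g μ)^{c(μ)}`, `c(μ) ≡ -μ^{-r}`, lies in `N` and `π Y = x` if `m = r`, `π Y = 0` otherwise.
[cite: Lang2002, Ch. I §3, Ch. V §5; AbramovichTemkinWlodarczyk2024, §5.1 (p. 1575)] -/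
theorem character_projection (p : ℕ) [Fact p.Prime] [Module (ZMod p) M] (N : Subgroup G) (π : G → M)
    (hπ : ∀ a ∈ N, ∀ b ∈ N, π (a * b) = π a + π b) (g : (ZMod p)ˣ → G) (hg : ∀ μ, g μ ∈ N) {x : M} {m r : ℕ}
    (hπg : ∀ μ, π (g μ) = ((μ : ZMod p) ^ m) • x) (hr : 2 ≤ r) (hrp : r ≤ p - 1) (hm1 : 1 ≤ m) (hmp : m ≤ p) :
    word p r g ∈ N ∧ π (word p r g) = if m = r then x else 0 := by
  haveI : NeZero p := ⟨(Fact.out : p.Prime).ne_zero⟩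
  have hmem : ∀ a ∈ ((Finset.univ : Finset (ZMod p)ˣ).toList.map fun μ => g μ ^ expo p r μ), a ∈ N := by
    intro a ha
    obtain ⟨μ, -, rfl⟩ := List.mem_map.mp ha
    exact N.pow_mem (hg μ) _
  obtain ⟨h1, h2⟩ := prod_mem_and_apply_prod N π hπ _ hmem
  refine ⟨h1, ?_⟩
  unfold word
  rw [h2, List.map_map, Finset.sum_map_toList]
  have hterm : ∀ μ : (ZMod p)ˣ, (π ∘ fun μ => g μ ^ expo p r μ) μ
      = (-((((μ⁻¹ : (ZMod p)ˣ) : ZMod p) ^ r) * (μ : ZMod p) ^ m)) • x := by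
    intro μ
    simp only [Function.comp_apply]
    rw [apply_pow_eq_nsmul N π hπ (hg μ), hπg μ, ← Nat.cast_smul_eq_nsmul (ZMod p), smul_smul, expo, ZMod.natCast_zmod_val,
      neg_mul]
  rw [Finset.sum_congr rfl fun μ _ => hterm μ, ← Finset.sum_smul, Finset.sum_neg_distrib]
  have hcard : Fintype.card (ZMod p) = p := ZMod.card p
  have hsum := CharacterSum.sum_units_inv_pow_mul_pow (K := ZMod p) r m (by rw [hcard]; exact hrp)
  rw [hcard] at hsum
  rw [hsum]
  by_cases hmr : m = r
  · rw [if_pos ((CharacterSum.dvd_pred_card_iff hr hrp hm1 hmp).mpr hmr), if_pos hmr, neg_neg, one_smul]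
  · rw [if_neg fun h => hmr ((CharacterSum.dvd_pred_card_iff hr hrp hm1 hmp).mp h), if_neg hmr, neg_zero, zero_smul]

end Literature.AlgebraicGeometry.Resolution.WeightedBlowup.EigenProjection
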